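import Literature.Geometry.Riemannian.PerelmanNoncollapsingTransport
import Literature.Geometry.Riemannian.CurvatureFamilyBounds
import Literature.Geometry.Riemannian.RicciFlowMetricLimit
import Literature.Geometry.Riemannian.RicciFlowVolumeDensity
import HarnessLib

/-!
# Perelman's no local collapsing theorem from the monotonicity of `μ` between INTERIOR times
# (small times by metric equivalence; Topping 2006, Thm. 8.3.1 with base time `T/4`)

The tree reduces the named fact `perelman_noLocalCollapsing` (`CanonicalNeighbourhoods.lean`;
Perelman 2002, §4, Thm. 4.1) to the monotonicity (T2) `μ(g(0), τ + t₀) ≤ μ(g(t₀), τ)` of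
Perelman's `μ`-functional **from the initial time `0`** of the flow
(`exists_isKappaNoncollapsed_of_muMonotone`, `perelman_noLocalCollapsing_of_muMonotone`), and (T2)
in turn to the solvability of a linear parabolic equation whose solution must be smooth on
`M × [0, t₀]` **up to `t = 0`**, where the coefficients (the flow) stop. Smoothness of solutions of
parabolic equations up to an end of the coefficient interval is boundary regularity; the interior
regularity theory available in the tree (Hörmander's theorem,
`Literature.Analysis.Hypoelliptic.hormander1967_thm11_proof`) does not provide it. This file
removes the need for it: **only the monotonicity between interior times `0 < b < t₀ < T` is
required**, i.e. only parabolic problems whose coefficients extend beyond both ends of the time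
interval.

* `PseudoRiemannianMetric.edist_le_mul_edist_of_val_le`, `ball_subset_ball_of_val_le` —
  **distance comparison**: `g₂(v,v) ≤ c g₁(v,v)` pointwise implies `d_{g₂} ≤ √c d_{g₁}` and
  `B_{g₁}(p, r/√c) ⊆ B_{g₂}(p, r)` (O'Neill 1983, Ch. 5, Def. 15: compare lengths of almost
  minimising curves);
* `IsRicciFlow.exists_mul_pow_le_vol_ball_of_le` — **small times need no entropy**: for a Ricci
  flow of Riemannian metrics on `[0, T)` on a closed manifold modelled on `ℝ^m` and `b₀ < T`, there
  is `c > 0` with `c rᵐ ≤ Vol_{g(t)} B_{g(t)}(p, r)` for all `t ∈ [0, b₀]`, `p`, `0 < r ≤ R`: the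
  curvature is bounded on `M × [0, b₀]` (`IsRicciFlow.exists_curvatureBoundedBy_Icc`), so the
  metrics `g(t)` are uniformly equivalent to `g(0)` (Topping 2006, Lemma 5.3.2,
  `IsRicciFlow.metric_equivalence`), balls and volumes (`dV_t = e^{−∫R} dV_0`, Topping (2.5.7),
  `IsRicciFlow.vol_eq_setLIntegral_exp`) are comparable, and `g(0)` has the Euclidean small-ball
  bound (`exists_mul_pow_le_vol_ball`, Chavel 2006, §III.3);
* `entropyDichotomy_of_le_muEntropy` — the entropy dichotomy of Topping's proof of Thm. 8.3.4 /
  (8.3.11) for ONE metric from a lower bound `m ≤ μ(g, s²/36)` (the single-slice content of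
  `entropyDichotomy_of_cutoffs`), with the explicit constant
  `ξ = (π/9)^{n/2} exp (m + n − (C₀/9 + n²) 2ⁿ⁺¹)`;
* `exists_isKappaNoncollapsed_of_muMonotone_interior` — **no local collapsing of one flow on a
  closed manifold modelled on `ℝ^m` from the interior monotonicity**
  `μ(g(b), τ + t₀ − b) ≤ μ(g(t₀), τ)` for `0 < b < t₀ < T`, `τ > 0`: times `t₀ ≤ T/2` by the
  small-time bound, times `t₀ > T/2` by the dichotomy with base time `b = T/4`
  (`exists_le_muEntropy`, Topping Lemma 8.1.8 (ii), for the single metric `g(T/4)`) and the halving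
  iteration `ofReal_mul_pow_le_vol_ball_of_doubling`;
* `perelman_noLocalCollapsing_of_muMonotone_interior` — **the named fact from the interior
  monotonicity over closed manifolds modelled on `ℝ^m`** (`perelman_noLocalCollapsing_of_euclideanModel`).

Everything is proved; no definition and no named fact is introduced; the named fact is NOT
discharged (the interior monotonicity is Perelman's entropy formula plus the backward conjugate
heat flow between interior times, `PerelmanNoncollapsingInteriorHeat.lean`).

## References

* G. Perelman, *The entropy formula for the Ricci flow and its geometric applications*,
  arXiv:math/0211159 (2002), §4, Thm. 4.1, Def. 4.2. [Perelman2002]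
* P. Topping, *Lectures on the Ricci flow*, LMS Lecture Note Series 325, CUP 2006, Lemma 5.3.2,
  (2.5.7), Lemma 8.1.8, §8.3, Thm. 8.3.1, Thm. 8.3.4, (8.3.11). [Topping2006]
* B. O'Neill, *Semi-Riemannian geometry*, Academic Press 1983, Ch. 5, Def. 15. [ONeill1983]
* I. Chavel, *Riemannian Geometry: A Modern Introduction*, 2nd ed., CUP 2006, §III.3. [Chavel2006]
-/

noncomputable section

open Bundle Set Function Filter Manifold MeasureTheory Module
open scoped Manifold ContDiff Topology ENNReal NNReal

namespace Literature.Geometry.Riemannian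

open Lorentzian Lorentzian.PseudoRiemannianMetric

universe u v w

/-! ### Distance comparison for pointwise comparable metrics -/

section Comparison

variable {E : Type*} [NormedAddCommGroup E] [NormedSpace ℝ E] [FiniteDimensional ℝ E]
  {H : Type*} [TopologicalSpace H] {I : ModelWithCorners ℝ E H}
  {M : Type*} [TopologicalSpace M] [ChartedSpace H M] [IsManifold I ∞ M] {n : ℕ∞ω}
  {g₁ g₂ : PseudoRiemannianMetric I n E (TangentSpace I : M → Type _)}

/-- **Arc length comparison**: if `g₂(v, v) ≤ c · g₁(v, v)` for all tangent vectors then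
`L_{g₂}(γ) ≤ √c · L_{g₁}(γ)` (O'Neill 1983, Ch. 5, Def. 11: `|v| = g(v,v)^{1/2}`).
[cite: ONeill1983, Ch. 5, Def. 11 (p. 131)] -/
theorem _root_.Literature.Geometry.Lorentzian.PseudoRiemannianMetric.length_le_mul_length_of_val_le
    (h₁ : g₁.IsRiemannian) (h₂ : g₂.IsRiemannian) {c : ℝ} (hc : 0 ≤ c)
    (hle : ∀ (x : M) (v : TangentSpace I x), g₂.val x v v ≤ c * g₁.val x v v)
    (γ : ℝ → M) (a b : ℝ) :
    g₂.length h₂ γ a b ≤ ENNReal.ofReal (Real.sqrt c) * g₁.length h₁ γ a b := by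
  rw [length_eq_lintegral, length_eq_lintegral, ← lintegral_const_mul' _ _ ENNReal.ofReal_ne_top]
  refine lintegral_mono fun t ↦ ?_
  rw [← ENNReal.ofReal_mul (Real.sqrt_nonneg _), ← Real.sqrt_mul hc]
  exact ENNReal.ofReal_le_ofReal (Real.sqrt_le_sqrt (hle _ _))

/-- **Distance comparison**: if `g₂(v, v) ≤ c · g₁(v, v)` for all tangent vectors (`c > 0`) then
`d_{g₂}(x, y) ≤ √c · d_{g₁}(x, y)` (compare with the `g₂`-length of almost minimising curves for
`g₁`; O'Neill 1983, Ch. 5, Def. 15). [cite: ONeill1983, Ch. 5, Def. 15 (p. 134)] -/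
theorem _root_.Literature.Geometry.Lorentzian.PseudoRiemannianMetric.edist_le_mul_edist_of_val_le
    (h₁ : g₁.IsRiemannian) (h₂ : g₂.IsRiemannian) {c : ℝ} (hc : 0 < c)
    (hle : ∀ (x : M) (v : TangentSpace I x), g₂.val x v v ≤ c * g₁.val x v v) (x y : M) :
    g₂.edist h₂ x y ≤ ENNReal.ofReal (Real.sqrt c) * g₁.edist h₁ x y := by
  have hk0 : ENNReal.ofReal (Real.sqrt c) ≠ 0 := by
    simpa [ENNReal.ofReal_eq_zero, not_le] using Real.sqrt_pos.mpr hc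
  have hktop : ENNReal.ofReal (Real.sqrt c) ≠ ⊤ := ENNReal.ofReal_ne_top
  rw [mul_comm, ← ENNReal.div_le_iff hk0 hktop]
  refine le_of_forall_gt_imp_ge_of_dense fun r hr ↦ ?_
  -- an almost minimising `C¹` curve for `g₁`
  letI := g₁.riemannianBundle h₁
  obtain ⟨γ, hγ0, hγ1, hγs, hlen⟩ := exists_lt_of_riemannianEDist_lt (I := I) (x := x) (y := y) hr
  have hlen' : g₁.length h₁ γ 0 1 < r := hlen
  refine ENNReal.div_le_of_le_mul ?_
  calc g₂.edist h₂ x y = g₂.edist h₂ (γ 0) (γ 1) := by rw [hγ0, hγ1]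
    _ ≤ g₂.length h₂ γ 0 1 := edist_le_length _ zero_le_one hγs
    _ ≤ ENNReal.ofReal (Real.sqrt c) * g₁.length h₁ γ 0 1 :=
        length_le_mul_length_of_val_le h₁ h₂ hc.le hle γ 0 1
    _ ≤ ENNReal.ofReal (Real.sqrt c) * r := by gcongr
    _ = r * ENNReal.ofReal (Real.sqrt c) := mul_comm _ _

/-- **Ball comparison**: if `g₂(v, v) ≤ c · g₁(v, v)` pointwise (`c > 0`) then
`B_{g₁}(p, r/√c) ⊆ B_{g₂}(p, r)` for real radii `r`. [cite: ONeill1983, Ch. 5, Def. 15 (p. 134)] -/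
theorem _root_.Literature.Geometry.Lorentzian.PseudoRiemannianMetric.ball_subset_ball_of_val_le
    (h₁ : g₁.IsRiemannian) (h₂ : g₂.IsRiemannian) {c : ℝ} (hc : 0 < c)
    (hle : ∀ (x : M) (v : TangentSpace I x), g₂.val x v v ≤ c * g₁.val x v v) (p : M) (r : ℝ) :
    g₁.ball p (ENNReal.ofReal (r / Real.sqrt c)) ⊆ g₂.ball p (ENNReal.ofReal r) := by
  intro y hy
  have hsc : 0 < Real.sqrt c := Real.sqrt_pos.mpr hc
  rw [PseudoRiemannianMetric.mem_ball, riemEDist_eq h₁] at hy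
  rw [PseudoRiemannianMetric.mem_ball, riemEDist_eq h₂]
  have hk0 : ENNReal.ofReal (Real.sqrt c) ≠ 0 := by
    simpa [ENNReal.ofReal_eq_zero, not_le] using hsc
  calc g₂.edist h₂ p y ≤ ENNReal.ofReal (Real.sqrt c) * g₁.edist h₁ p y :=
        edist_le_mul_edist_of_val_le h₁ h₂ hc hle p y
    _ = g₁.edist h₁ p y * ENNReal.ofReal (Real.sqrt c) := mul_comm _ _
    _ < ENNReal.ofReal (r / Real.sqrt c) * ENNReal.ofReal (Real.sqrt c) :=
        ENNReal.mul_lt_mul_left hk0 ENNReal.ofReal_ne_top hy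
    _ = ENNReal.ofReal r := by
        rcases le_or_gt r 0 with hr | hr
        · have h0 : r / Real.sqrt c ≤ 0 := div_nonpos_of_nonpos_of_nonneg hr hsc.le
          simp [ENNReal.ofReal_of_nonpos h0, ENNReal.ofReal_of_nonpos hr]
        · rw [← ENNReal.ofReal_mul (div_pos hr hsc).le, div_mul_cancel₀ _ hsc.ne']

end Comparison

/-! ### Small times: volume of balls along the flow without entropy -/

section SmallTimes

variable {m : ℕ} {H : Type v} [TopologicalSpace H]
  {I : ModelWithCorners ℝ (EuclideanSpace ℝ (Fin m)) H} [I.Boundaryless]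
  {M : Type w} [TopologicalSpace M] [ChartedSpace H M] [IsManifold I ∞ M]
  [T2Space M] [CompactSpace M] [MeasurableSpace M] [BorelSpace M]
  {g : ℝ → PseudoRiemannianMetric I ∞ (EuclideanSpace ℝ (Fin m)) (TangentSpace I : M → Type _)}
  {cov : ℝ → CovariantDerivative I (EuclideanSpace ℝ (Fin m)) (TangentSpace I : M → Type _)}

/-- **Volume comparison along the flow on a compact time interval**: for a Ricci flow of
Riemannian metrics on `[0, T)` on a closed manifold modelled on `ℝ^m` and `0 < b₀ < T` there is
`C₁ > 0` with `C₁ · Vol_{g(0)}(A) ≤ Vol_{g(t)}(A)` for all `t ∈ [0, b₀]` and measurable `A`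
(`dV_t = e^{−∫₀ᵗ R} dV_0`, Topping 2006, (2.5.7), and `|R| ≤ K` on `M × [0, b₀]`).
[cite: Topping2006, (2.5.7) (p. 33)] -/
theorem IsRicciFlow.exists_mul_vol_le_vol {T : ℝ} (hflow : IsRicciFlow g cov (Ico 0 T))
    (hRiem : ∀ t ∈ Ico 0 T, (g t).IsRiemannian) {b₀ : ℝ} (hb₀ : 0 < b₀) (hb₀T : b₀ < T) :
    ∃ C₁ : ℝ, 0 < C₁ ∧ ∀ t ∈ Icc 0 b₀, ∀ A : Set M, MeasurableSet A →
      ENNReal.ofReal C₁ * (g 0).vol A ≤ (g t).vol A := by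
  have hsub : Icc 0 b₀ ⊆ Ico 0 T := Icc_subset_Ico_right hb₀T
  have hflow' : IsRicciFlow g cov (Icc 0 b₀) := hflow.mono hsub
  have hRiem' : ∀ t ∈ Icc 0 b₀, (g t).IsRiemannian := fun t ht ↦ hRiem t (hsub ht)
  -- `|R| ≤ K` on `M × [0, b₀]`
  have hRc : ContinuousOn (fun p : M × ℝ ↦ (g p.2).scalarCurvatureWith (cov p.2) p.1)
      (univ ×ˢ Icc 0 b₀) := hflow'.continuousOn_scalarCurvatureWith_prod (uniqueDiffOn_Icc hb₀)
  obtain ⟨K, hK⟩ := (isCompact_univ.prod isCompact_Icc).exists_bound_of_continuousOn hRc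
  have h0 : (0 : ℝ) ∈ Icc 0 b₀ := ⟨le_rfl, hb₀.le⟩
  refine ⟨Real.exp (-(K * b₀)), Real.exp_pos _, fun t ht A hA ↦ ?_⟩
  rw [hflow'.vol_eq_setLIntegral_exp (convex_Icc 0 b₀) hRiem' h0 ht hA, PseudoRiemannianMetric.vol,
    ← setLIntegral_const]
  refine lintegral_mono fun p ↦ ENNReal.ofReal_le_ofReal (Real.exp_le_exp.2 ?_)
  -- `∫₀ᵗ R(p, τ) dτ ≤ K t ≤ K b₀`
  have hint : ‖∫ τ in (0 : ℝ)..t, (g τ).scalarCurvatureWith (cov τ) p‖ ≤ K * |t - 0| := by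
    refine intervalIntegral.norm_integral_le_of_norm_le_const fun τ hτ ↦ ?_
    rw [uIoc_of_le ht.1] at hτ
    exact hK (p, τ) ⟨mem_univ _, hτ.1.le, hτ.2.trans ht.2⟩
  rw [sub_zero, abs_of_nonneg ht.1] at hint
  have hKnn : 0 ≤ K := (norm_nonneg _).trans (hK (p, 0) ⟨mem_univ _, h0⟩)
  have h1 := (Real.norm_eq_abs _ ▸ hint)
  have h2 : ∫ τ in (0 : ℝ)..t, (g τ).scalarCurvatureWith (cov τ) p ≤ K * b₀ :=
    ((le_abs_self _).trans h1).trans (mul_le_mul_of_nonneg_left ht.2 hKnn)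
  linarith

/-- **Small times need no entropy: balls of radius `≤ R` have volume `≥ c rᵐ` uniformly on
`[0, b₀]`.** For a Ricci flow of Riemannian metrics on `[0, T)` on a closed manifold modelled on
`ℝ^m`, `0 < b₀ < T` and any `R` there is `c > 0` with `c rᵐ ≤ Vol_{g(t)}(B_{g(t)}(p, r))` for all
`t ∈ [0, b₀]`, `p ∈ M`, `0 < r ≤ R`. Proof: `|Rm| ≤ K` on `M × [0, b₀]`
(`exists_curvatureBoundedBy_Icc`), hence `e^{−2mKt} g(0) ≤ g(t) ≤ e^{2mKt} g(0)` (Topping 2006,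
Lemma 5.3.2, `IsRicciFlow.metric_equivalence`), so `B_0(p, r/L) ⊆ B_t(p, r)` with `L = e^{mKb₀}`
(`ball_subset_ball_of_val_le`); volumes compare by `exists_mul_vol_le_vol`, and `g(0)` satisfies
`c₀ rᵐ ≤ Vol_0 B_0(p, r)` for `r ≤ R` (`exists_mul_pow_le_vol_ball`).
[cite: Topping2006, Lemma 5.3.2 and (2.5.7)] [cite: Chavel2006, §III.3] -/
theorem IsRicciFlow.exists_mul_pow_le_vol_ball_of_le {T : ℝ} (hflow : IsRicciFlow g cov (Ico 0 T))
    (hRiem : ∀ t ∈ Ico 0 T, (g t).IsRiemannian) {b₀ : ℝ} (hb₀ : 0 < b₀) (hb₀T : b₀ < T) (R : ℝ) :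
    ∃ c : ℝ, 0 < c ∧ ∀ t ∈ Icc 0 b₀, ∀ (p : M) (r : ℝ), 0 < r → r ≤ R →
      ENNReal.ofReal (c * r ^ m) ≤ (g t).vol ((g t).ball p (ENNReal.ofReal r)) := by
  have hsub : Icc 0 b₀ ⊆ Ico 0 T := Icc_subset_Ico_right hb₀T
  have hflow' : IsRicciFlow g cov (Icc 0 b₀) := hflow.mono hsub
  have hRiem' : ∀ t ∈ Icc 0 b₀, (g t).IsRiemannian := fun t ht ↦ hRiem t (hsub ht)
  have h0 : (0 : ℝ) ∈ Icc 0 b₀ := ⟨le_rfl, hb₀.le⟩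
  have hg0 : (g 0).IsRiemannian := hRiem' 0 h0
  -- curvature bound and metric equivalence on `[0, b₀]`
  obtain ⟨K₀, hK₀⟩ := hflow.exists_curvatureBoundedBy_Icc hRiem hb₀T
  set K : ℝ := max K₀ 0 with hKdef
  have hK0 : 0 ≤ K := le_max_right _ _
  have hK : ∀ t ∈ Icc 0 b₀, CurvatureBoundedBy (g t) (cov t) K := fun t ht ↦
    (hK₀ t ht).mono (le_max_left _ _)
  have hRic : ∀ t ∈ Icc 0 b₀, ∀ (x : M) (X : TangentSpace I x),
      |(cov t).ricci x X X| ≤ (finrank ℝ (EuclideanSpace ℝ (Fin m)) * K) * (g t).val x X X :=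
    fun t ht x X ↦ (hK t ht).abs_ricci_le (hRiem' t ht) x X
  set L2 : ℝ := Real.exp (2 * (finrank ℝ (EuclideanSpace ℝ (Fin m)) * K) * b₀) with hL2
  have hL2pos : 0 < L2 := Real.exp_pos _
  have hL2one : 1 ≤ L2 := Real.one_le_exp (by positivity)
  have hcomp : ∀ t ∈ Icc 0 b₀, ∀ (x : M) (X : TangentSpace I x),
      (g t).val x X X ≤ L2 * (g 0).val x X X := by
    intro t ht x X
    have h := (hflow'.metric_equivalence hRiem' hRic t ht x X).2
    refine h.trans (mul_le_mul_of_nonneg_right (Real.exp_le_exp.2 ?_) ?_)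
    · exact mul_le_mul_of_nonneg_left ht.2 (by positivity)
    · by_cases hX : X = 0
      · simp [hX]
      · exact (hg0 x X hX).le
  -- the constants
  obtain ⟨C₁, hC₁, hvol⟩ := hflow.exists_mul_vol_le_vol hRiem hb₀ hb₀T
  obtain ⟨c₀, hc₀, hball⟩ := PseudoRiemannianMetric.exists_mul_pow_le_vol_ball (I := I) hg0 R
  have hnm : finrank ℝ (EuclideanSpace ℝ (Fin m)) = m := by simp
  rw [hnm] at hball
  set L : ℝ := Real.sqrt L2 with hL
  have hLpos : 0 < L := Real.sqrt_pos.2 hL2pos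
  have hLone : 1 ≤ L := by rw [hL, ← Real.sqrt_one]; exact Real.sqrt_le_sqrt hL2one
  refine ⟨C₁ * (c₀ / L ^ m), by positivity, fun t ht p r hr hrR ↦ ?_⟩
  -- `B_0(p, r/L) ⊆ B_t(p, r)`, volumes compared at time `t`, then the bound for `g(0)`
  have hincl : (g 0).ball p (ENNReal.ofReal (r / L)) ⊆ (g t).ball p (ENNReal.ofReal r) :=
    ball_subset_ball_of_val_le hg0 (hRiem' t ht) hL2pos (hcomp t ht) p r
  have hmeas : MeasurableSet ((g 0).ball p (ENNReal.ofReal (r / L))) :=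
    (PseudoRiemannianMetric.isOpen_ball hg0 p _).measurableSet
  have hrL : 0 < r / L := div_pos hr hLpos
  have hrLR : r / L ≤ R := (div_le_self hr.le hLone).trans hrR
  calc ENNReal.ofReal (C₁ * (c₀ / L ^ m) * r ^ m)
      = ENNReal.ofReal C₁ * ENNReal.ofReal (c₀ * (r / L) ^ m) := by
        rw [← ENNReal.ofReal_mul hC₁.le]
        congr 1
        rw [div_pow]
        field_simp
    _ ≤ ENNReal.ofReal C₁ * (g 0).vol ((g 0).ball p (ENNReal.ofReal (r / L))) := by
        gcongr
        exact hball p (r / L) hrL hrLR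
    _ ≤ (g t).vol ((g 0).ball p (ENNReal.ofReal (r / L))) := hvol t ht _ hmeas
    _ ≤ (g t).vol ((g t).ball p (ENNReal.ofReal r)) := (g t).vol_mono hincl

end SmallTimes

/-! ### The entropy dichotomy for one metric from a lower bound on `μ` -/

section Dichotomy

variable {E : Type*} [NormedAddCommGroup E] [NormedSpace ℝ E] [FiniteDimensional ℝ E]
  {H : Type*} [TopologicalSpace H] {I : ModelWithCorners ℝ E H} [I.Boundaryless]
  {M : Type*} [TopologicalSpace M] [T2Space M] [CompactSpace M]
  [ChartedSpace H M] [IsManifold I ∞ M] [MeasurableSpace M] [BorelSpace M]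

/-- **The entropy dichotomy bound for one metric** (Topping 2006, proof of Thm. 8.3.4 and
(8.3.11); the single-slice content of `entropyDichotomy_of_cutoffs`): for a Riemannian metric `g`
with continuous scalar curvature on a closed manifold, admitting a cutoff `χ` adapted to
`B(p, s)` with `|∇χ|² ≤ C₀/s²`, a lower bound `m ≤ μ(g, s²/36)`, the curvature bound
`|Rm| ≤ s⁻²` on `B(p, s)` and the doubling `Vol B(p, s) ≤ 2ⁿ⁺¹ Vol B(p, s/2)` imply
`ξ sⁿ ≤ Vol B(p, s)` with `ξ = (π/9)^{n/2} exp (m + n − (C₀/9 + n²) 2ⁿ⁺¹)`, `n = dim M`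
(Lemma 8.3.5 via `muEntropy_le_of_cutoff`, then the arithmetic `mul_pow_le_of_entropy_estimate'`).
[cite: Topping2006, §8.3, Thm. 8.3.4, Lemma 8.3.5 and (8.3.11)] -/
theorem entropyDichotomy_of_le_muEntropy
    {g : PseudoRiemannianMetric I ∞ E (TangentSpace I : M → Type _)} (hG : g.IsRiemannian)
    {cov : CovariantDerivative I E (TangentSpace I : M → Type _)}
    (hRc : Continuous fun x ↦ g.scalarCurvatureWith cov x) {C₀ m : ℝ} {p : M} {s : ℝ} (hs : 0 < s)
    {χ : M → ℝ} (hχs : ContMDiff I 𝓘(ℝ, ℝ) ∞ χ) (hχ0 : ∀ x, 0 ≤ χ x) (hχ1 : ∀ x, χ x ≤ 1)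
    (hχB : ∀ x ∈ g.ball p (ENNReal.ofReal (s / 2)), χ x = 1)
    (hχsupp : tsupport χ ⊆ g.ball p (ENNReal.ofReal s)) (hχK : ∀ x, g.gradSq χ x ≤ C₀ / s ^ 2)
    (hμ : (m : EReal) ≤ g.muEntropy cov (1 / 36 * s ^ 2))
    (hcurv : CurvatureBoundedOn g cov (g.ball p (ENNReal.ofReal s)) (s⁻¹ ^ 2))
    (hdoub : g.vol (g.ball p (ENNReal.ofReal s)) ≤
      2 ^ (finrank ℝ E + 1) * g.vol (g.ball p (ENNReal.ofReal (s / 2)))) :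
    ENNReal.ofReal ((Real.pi / 9) ^ ((finrank ℝ E : ℝ) / 2) *
        Real.exp (m + finrank ℝ E - (C₀ / 9 + (finrank ℝ E : ℝ) ^ 2) * 2 ^ (finrank ℝ E + 1)) *
        s ^ finrank ℝ E) ≤ g.vol (g.ball p (ENNReal.ofReal s)) := by
  set n := finrank ℝ E with hn
  -- Lemma 8.3.5 from the cutoff at `τ = s²/36`, `r = s`, `K = C₀/s²`
  have hC₀ : 0 ≤ 4 * (1 / 36 * s ^ 2) * (C₀ / s ^ 2) := by
    have h1 : 0 ≤ C₀ / s ^ 2 := (g.gradSq_nonneg hG χ p).trans (hχK p)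
    positivity
  have h₁' := muEntropy_le_of_cutoff hG hRc hs (τ := 1 / 36 * s ^ 2) (by positivity)
    hχs hχ0 hχ1 hχB hχsupp hχK
  have hreal := EReal.coe_le_coe_iff.1 (hμ.trans h₁')
  -- the volumes as real numbers
  set V₁ := (g.vol (g.ball p (ENNReal.ofReal s))).toReal with hV₁
  set V₂ := (g.vol (g.ball p (ENNReal.ofReal (s / 2)))).toReal with hV₂
  have hfin₁ := g.vol_ball_lt_top p (ENNReal.ofReal s)
  have hfin₂ := g.vol_ball_lt_top p (ENNReal.ofReal (s / 2))
  have hV₂pos : 0 < V₂ := ENNReal.toReal_pos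
    (PseudoRiemannianMetric.vol_ball_pos hG p (ENNReal.ofReal_pos.2 (half_pos hs))).ne' hfin₂.ne
  have hV : V₂ ≤ V₁ := ENNReal.toReal_mono hfin₁.ne
    (g.vol_mono (g.ball_mono p (ENNReal.ofReal_le_ofReal (by linarith))))
  -- the curvature integral and the doubling property in `ℝ`
  have hJ : ∫ x in g.ball p (ENNReal.ofReal s), |g.scalarCurvatureWith cov x| ∂g.riemVolume ≤
      (n : ℝ) ^ 2 * (s⁻¹ ^ 2) * V₁ :=
    setIntegral_abs_scalarCurvatureWith_le hG hcurv hfin₁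
  have hdoub' : V₁ ≤ 2 ^ (n + 1) * V₂ := by
    have := ENNReal.toReal_mono (ENNReal.mul_ne_top (by simp) hfin₂.ne) hdoub
    simpa [hV₁, hV₂, ENNReal.toReal_mul, ENNReal.toReal_pow] using this
  -- the real-variable lemma with `a = 4 (s²/36) (C₀/s²) = C₀/9`, and back to `ℝ≥0∞`
  have hkey := mul_pow_le_of_entropy_estimate' n hs hV₂pos hV hC₀
    (by simpa [mul_assoc, mul_comm, mul_left_comm] using hreal) hJ hdoub'
  have ha : 4 * (1 / 36 * s ^ 2) * (C₀ / s ^ 2) = C₀ / 9 := by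
    field_simp
    ring
  rw [ha] at hkey
  exact ENNReal.ofReal_le_of_le_toReal hkey

end Dichotomy

/-! ### One flow on a closed manifold modelled on `ℝ^m`: interior monotonicity suffices -/

section Interior

variable {m : ℕ} {H : Type v} [TopologicalSpace H]
  {I : ModelWithCorners ℝ (EuclideanSpace ℝ (Fin m)) H} [I.Boundaryless]
  {M : Type w} [TopologicalSpace M] [ChartedSpace H M] [IsManifold I ∞ M]
  [T2Space M] [SecondCountableTopology M] [CompactSpace M] [MeasurableSpace M] [BorelSpace M]

/-- **No local collapsing of one flow from the monotonicity of `μ` between interior times**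
(Perelman 2002, §4, Thm. 4.1; Topping 2006, Thm. 8.3.1, with base time `T/4` in place of `0`).
For a Ricci flow of Riemannian metrics `(g, cov)` on `[0, T)`, `T > 0`, on a closed manifold
modelled on `ℝ^m`, IF `μ(g(b), τ + t₀ − b) ≤ μ(g(t₀), τ)` whenever `0 < b < t₀ < T` and `τ > 0`
(Topping (8.3.10) between interior times), then there is `κ > 0` such that the flow is
`κ`-noncollapsed (`IsKappaNoncollapsed`) on every scale `r₀ < √T`. Times `t₀ ≤ T/2`:
`exists_mul_pow_le_vol_ball_of_le` (no entropy). Times `t₀ > T/2`: for `s ≤ r₀ < √T`,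
`m ≤ μ(g(T/4), s²/36 + t₀ − T/4) ≤ μ(g(t₀), s²/36)` with `m` the lower bound of
`exists_le_muEntropy` for `g(T/4)` on `(0, T/36 + T]`, so `entropyDichotomy_of_le_muEntropy`
(cutoffs from `exists_metric_cutoff`) feeds the halving iteration
`ofReal_mul_pow_le_vol_ball_of_doubling`.
[cite: Perelman2002, §4, Thm. 4.1] [cite: Topping2006, §8.3, Thm. 8.3.1 and (8.3.10)] -/
theorem exists_isKappaNoncollapsed_of_muMonotone_interior {T : ℝ} (hT : 0 < T)
    (g : ℝ → PseudoRiemannianMetric I ∞ (EuclideanSpace ℝ (Fin m)) (TangentSpace I : M → Type _))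
    (cov : ℝ → CovariantDerivative I (EuclideanSpace ℝ (Fin m)) (TangentSpace I : M → Type _))
    (hflow : IsRicciFlow g cov (Ico 0 T)) (hRiem : ∀ t ∈ Ico 0 T, (g t).IsRiemannian)
    (h₂ : ∀ b t₀ : ℝ, 0 < b → b < t₀ → t₀ < T → ∀ τ : ℝ, 0 < τ →
      (g b).muEntropy (cov b) (τ + (t₀ - b)) ≤ (g t₀).muEntropy (cov t₀) τ) :
    ∃ κ : ℝ, 0 < κ ∧ ∀ r₀ : ℝ, 0 < r₀ → r₀ < Real.sqrt T →
      IsKappaNoncollapsed g cov (Ico 0 T) κ r₀ := by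
  set n := finrank ℝ (EuclideanSpace ℝ (Fin m)) with hn
  have hnm : n = m := by simp [hn]
  have hRc : ∀ t ∈ Ico 0 T, Continuous fun x ↦ (g t).scalarCurvatureWith (cov t) x := fun t ht ↦
    (contMDiff_scalarCurvatureWith_holds I M (g t) (cov t) (hflow.isLeviCivita t ht)).continuous
  obtain ⟨C₀, hC₀⟩ := exists_metric_cutoff.{0, v, w}
  -- the base time `T/4` and its lower bound `mlb`
  have hT4 : T / 4 ∈ Ico 0 T := ⟨by positivity, by linarith⟩
  obtain ⟨mlb, hmlb⟩ := exists_le_muEntropy (hRiem _ hT4) (hflow.isLeviCivita _ hT4) (T / 36 + T)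
  -- the entropy constant and the small-time constant
  set ξ : ℝ := (Real.pi / 9) ^ ((n : ℝ) / 2) *
    Real.exp (mlb + n - (C₀ / 9 + (n : ℝ) ^ 2) * 2 ^ (n + 1)) with hξ
  have hξpos : 0 < ξ := by positivity
  obtain ⟨c, hc, hsmall⟩ := hflow.exists_mul_pow_le_vol_ball_of_le hRiem (half_pos hT)
    (half_lt_self hT) (Real.sqrt T)
  refine ⟨min ξ c, lt_min hξpos hc, fun r₀ hr₀ hr₀T x₀ t₀ hS hcurv ↦ ?_⟩
  have ht₀ : t₀ ∈ Icc (t₀ - r₀ ^ 2) t₀ := ⟨by nlinarith, le_rfl⟩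
  have ht₀' : t₀ ∈ Ico 0 T := hS ht₀
  rcases le_or_gt t₀ (T / 2) with hsm | hlarge
  · -- small times: no entropy needed
    calc ENNReal.ofReal (min ξ c * r₀ ^ n) ≤ ENNReal.ofReal (c * r₀ ^ m) := by
          rw [hnm]; exact ENNReal.ofReal_le_ofReal (by gcongr; exact min_le_right _ _)
      _ ≤ (g t₀).vol ((g t₀).ball x₀ (ENNReal.ofReal r₀)) :=
          hsmall t₀ ⟨ht₀'.1, hsm⟩ x₀ r₀ hr₀ hr₀T.le
  · -- interior times `t₀ > T/2`: the entropy dichotomy with base time `T/4`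
    refine PseudoRiemannianMetric.ofReal_mul_pow_le_vol_ball_of_doubling (hRiem t₀ ht₀') x₀ hr₀
      (lt_min hξpos hc) fun s hs hsr hdoub ↦ ?_
    have hsT : s < Real.sqrt T := hsr.trans_lt hr₀T
    have hs2 : s ^ 2 < T := by
      calc s ^ 2 < Real.sqrt T ^ 2 := by gcongr
        _ = T := Real.sq_sqrt hT.le
    -- `mlb ≤ μ(g(T/4), s²/36 + (t₀ - T/4)) ≤ μ(g t₀, s²/36)`
    have hμ : (mlb : EReal) ≤ (g t₀).muEntropy (cov t₀) (1 / 36 * s ^ 2) := by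
      calc (mlb : EReal) ≤ (g (T / 4)).muEntropy (cov (T / 4)) (1 / 36 * s ^ 2 + (t₀ - T / 4)) :=
            hmlb _ ⟨by nlinarith [ht₀'.2], by nlinarith [ht₀'.2]⟩
        _ ≤ (g t₀).muEntropy (cov t₀) (1 / 36 * s ^ 2) :=
            h₂ (T / 4) t₀ (by positivity) (by linarith) ht₀'.2 _ (by positivity)
    obtain ⟨χ, hχs, hχ0, hχ1, hχB, hχsupp, hχK⟩ := hC₀ I M (g t₀) (hRiem t₀ ht₀') x₀ s hs
    have hcurv' : CurvatureBoundedOn (g t₀) (cov t₀) ((g t₀).ball x₀ (ENNReal.ofReal s)) (s⁻¹ ^ 2) := by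
      refine (hcurv t₀ ht₀).mono
        (PseudoRiemannianMetric.ball_mono _ _ (ENNReal.ofReal_le_ofReal hsr)) ?_
      gcongr
    have hkey := entropyDichotomy_of_le_muEntropy (hRiem t₀ ht₀') (hRc t₀ ht₀') hs hχs hχ0 hχ1
      hχB hχsupp hχK hμ hcurv' hdoub
    calc ENNReal.ofReal (min ξ c * s ^ n) ≤ ENNReal.ofReal (ξ * s ^ n) :=
          ENNReal.ofReal_le_ofReal (by gcongr; exact min_le_left _ _)
      _ ≤ (g t₀).vol ((g t₀).ball x₀ (ENNReal.ofReal s)) := hkey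

end Interior

/-! ### Interior monotonicity over closed manifolds modelled on `ℝ^m` ⇒ the named fact -/

/-- **Perelman's no local collapsing theorem I from the monotonicity of `μ` between interior
times** (Perelman 2002, §4, Thm. 4.1; Topping 2006, Thm. 8.3.1 and (8.3.10)). Hypothesis `h₂`:
on every closed manifold modelled on `EuclideanSpace ℝ (Fin m)` (all `m`; boundaryless model, any
Borel structure) carrying a Ricci flow of Riemannian metrics `(g, cov)` on `[0, T)`, `T > 0`, for
all `0 < b < t₀ < T` and `τ > 0`: `μ(g(b), τ + (t₀ − b)) ≤ μ(g(t₀), τ)` — Topping's (8.3.10)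
between INTERIOR times only (the flow extends beyond both `b` and `t₀`). Conclusion:
`perelman_noLocalCollapsing` in full generality (`perelman_noLocalCollapsing_of_euclideanModel` and
`exists_isKappaNoncollapsed_of_muMonotone_interior`). NOT a discharge of the named fact: `h₂` is
Perelman's entropy formula together with the backward conjugate heat flow between interior times.
[cite: Perelman2002, §4, Thm. 4.1] [cite: Topping2006, §8.3, Thm. 8.3.1 and (8.3.10)] -/
theorem perelman_noLocalCollapsing_of_muMonotone_interior
    (h₂ : ∀ (m : ℕ) {H : Type v} [TopologicalSpace H]
      (I : ModelWithCorners ℝ (EuclideanSpace ℝ (Fin m)) H) [I.Boundaryless]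
      (M : Type w) [TopologicalSpace M] [T2Space M] [SecondCountableTopology M] [CompactSpace M]
      [ChartedSpace H M] [IsManifold I ∞ M] [MeasurableSpace M] [BorelSpace M] (T : ℝ), 0 < T →
      ∀ (g : ℝ → PseudoRiemannianMetric I ∞ (EuclideanSpace ℝ (Fin m)) (TangentSpace I : M → Type _))
        (cov : ℝ → CovariantDerivative I (EuclideanSpace ℝ (Fin m)) (TangentSpace I : M → Type _)),
        IsRicciFlow g cov (Ico 0 T) → (∀ t ∈ Ico 0 T, (g t).IsRiemannian) →
        ∀ b t₀ : ℝ, 0 < b → b < t₀ → t₀ < T → ∀ τ : ℝ, 0 < τ →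
          (g b).muEntropy (cov b) (τ + (t₀ - b)) ≤ (g t₀).muEntropy (cov t₀) τ) :
    perelman_noLocalCollapsing.{u, v, w} :=
  perelman_noLocalCollapsing_of_euclideanModel fun m _H _ I _ M _ _ _ _ _ _ _ _ T hT g cov hflow hRiem ↦
    exists_isKappaNoncollapsed_of_muMonotone_interior hT g cov hflow hRiem
      (h₂ m I M T hT g cov hflow hRiem)

end Literature.Geometry.Riemannian

end
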